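import Literature.AlgebraicGeometry.Frobenioids.Thm42Assembly
import HarnessLib

/-!
# [FrdI] Theorem 4.2 (ii) + non-dilation: `Ψ` preserves Div-equivalent pairs of base-isomorphisms

Mochizuki, *The geometry of Frobenioids I: the general theory*, Kyushu J. Math. **62** (2008)
293–400, §4; the sentence of the proof of Theorem 4.9, kurims text p. 90 ll. 77–79 (render
`paper:url-bbf705efa10f`, read on the page) [cite: MochizukiFrdI2008, Thm. 4.9 p.90]:

> "since `Ψ` preserves pre-steps [cf. Theorem 3.4, (ii)], primary steps [cf. Theorem 4.2, (i)],
> Div-equivalent pairs of base-isomorphisms [cf. Theorem 4.2, (ii); the fact that `Φ_i` is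
> non-dilating], and cartesian diagrams as in Proposition 4.1, (iii) …"

with Theorem 4.2 (ii), statement p. 77: "There exists a unique isomorphism `Ψ^Prime` between the
FUNCTORS `Ob(C_i^bs-iso) ∋ A_i ↦ Prime(Φ_i(A_i))` on `C_i^bs-iso`", and Def. 1.1 (i)/(ii) p. 19
(non-dilating: an endomorphism `f^*` of `Φ(A)` induced by `f ∈ End_D(A)` with `f^*(a) ≼ a` for every
primary `a` is the identity).

PROOF-ONLY file (seat abc-iut-w4-d099; no definitions, nothing asserted as a `Prop`). It DISCHARGES, in
the setting of the proof of Thm. 4.2 (`FrdI.T42.Setting`: Frobenioids of perfect and isotropic type,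
`Φ_i` perf-factorial, `Ψ`, `Ψ⁻¹` with the conclusions of Thm. 3.4 (ii)(iii)) and for `Φ₂` NON-DILATING,
the hypothesis binder

  `hdiveq : ∀ ⦃X Y⦄ (φ ψ : X ⟶ Y), IsBaseIso F₁ φ → IsBaseIso F₁ ψ → DivEquivalent F₁ φ ψ →
      DivEquivalent F₂ (Ψ.functor.map φ) (Ψ.functor.map ψ)`

carried by row T49-L08′ `FrdI.T49.PsiPreservesTwinPrimary'` (seat abc-iut-w4-d105,
`isTwinPrimary_map_of_coprimary_squares`) and by
`FrdI.T49.exists_twinPrimary_pair_of_isStrictlyRational` (seat abc-iut-w5-d021), i.e. the input of the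
twin-primary transport in the proof of Thm. 4.9 that print attributes to "Theorem 4.2, (ii); the fact
that `Φ_i` is non-dilating" (`FrdI.T42.Setting.divEquivalent_map`).

Route (exactly print's bracket): `Ψ^Prime` is FUNCTORIAL on `C^bs-iso`
(`PreFrobenioid.primesEquiv_naturality_baseIso_mem`, seat abc-iut-w4-d090, rows T42-L09/L10: for a
base-isomorphism `γ : A → A′`, primes corresponding under `Φ₁(Base γ)` are carried by `Ψ^Prime` to primes
corresponding under `Φ₂(Base Ψγ)`; its input "`Ψ^Prime` is characterised by the primary pre-steps INTO
the object", `PreFrobenioid.existsUnique_primesEquiv`, row T42-L08, with "`Ψ`, `Ψ⁻¹` preserve primary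
pre-steps" DISCHARGED by rows T42-L04–L07, `Setting.isPrimaryPreStep_map` /
`Setting.isPrimaryPreStep_inverse_map`). Hence for Div-equivalent base-isomorphisms `φ, ψ : X → Y`
[`Φ₁(Base φ) = Φ₁(Base ψ)`] the automorphism `u := Φ₂(Base Ψψ)⁻¹ ∘ Φ₂(Base Ψφ)` of `Φ₂((Ψ Y)_D)` —
induced by the endomorphism `Base(Ψψ)⁻¹ ≫ Base(Ψφ)` of `(Ψ Y)_D` — maps every prime of `Φ₂((Ψ Y)_D)`
into itself, so `u(a) ≼ a` for every primary `a`; `Φ₂` non-dilating ⇒ `u = id`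
(`PreFrobenioid.pull_eq_id_of_precsim_of_isPrimary`, seat abc-iut-w4-d068) ⇒
`Φ₂(Base Ψφ) = Φ₂(Base Ψψ)`. Nothing of [FrdI] is restated; nothing here bears on [IUTchIII] Cor. 3.12.
-/

namespace Literature.AlgebraicGeometry.Frobenioids

open CategoryTheory Opposite

namespace FrdI.T42

universe w v v' u u'

variable {D₁ : Type u} [Category.{v} D₁] {Φ₁ : D₁ᵒᵖ ⥤ CommMonCat.{w}} {C₁ : Type u'} [Category.{v'} C₁]
  {D₂ : Type u} [Category.{v} D₂] {Φ₂ : D₂ᵒᵖ ⥤ CommMonCat.{w}} {C₂ : Type u'} [Category.{v'} C₂]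
  {F₁ : C₁ ⥤ ElemFrobenioid Φ₁} {F₂ : C₂ ⥤ ElemFrobenioid Φ₂} {Ψ : C₁ ≌ C₂}

set_option backward.isDefEq.respectTransparency false in
/-- In the setting of Thm. 4.2, `Ψ` maps base-isomorphisms to base-isomorphisms (Prop. 1.7 (ii): a
base-isomorphism is a morphism of Frobenius type followed by a pre-step, and `Ψ` preserves both,
Thm. 3.4 (ii)(iii)). [cite: MochizukiFrdI2008, Thm. 3.4 (iii) p.64] -/
theorem Setting.isBaseIso_map (S : Setting F₁ F₂ Ψ) {A B : C₁} (γ : A ⟶ B)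
    (hγ : PreFrobenioid.IsBaseIso F₁ γ) : PreFrobenioid.IsBaseIso F₂ (Ψ.functor.map γ) := by
  obtain ⟨X, β, α, hfac, hβ, hα⟩ :=
    (PreFrobenioid.isBaseIso_iff_exists_frobeniusType_preStep F₁ S.isFrobenioid₁ γ).1 hγ
  rw [← hfac, Functor.map_comp]
  exact PreFrobenioid.IsBaseIso.comp F₂ (S.frobeniusType_map β hβ).2 (S.preStep_map α hα).2

set_option backward.isDefEq.respectTransparency false in
/-- **`Ψ^Prime` is functorial on `C^bs-iso`, element form** (Thm. 4.2 (ii), p. 77: "`Ψ^Prime` … an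
isomorphism between the functors `A_i ↦ Prime(Φ_i(A_i))` on `C_i^bs-iso`"; proof p. 80 ll. 44–45), in the
`T42.Setting` with the Thm. 4.2 (i) inputs of rows T42-L04–L07 discharged: there is a family of bijections
`e_A : Prime(Φ₁(A)) ≃ Prime(Φ₂(Ψ A))` [namely `Ψ^Prime`] such that for EVERY base-isomorphism
`γ : A → A′` and every primary `x ∈ Φ₂((Ψ A′)_D)` of class `e_{A′} 𝔭′`, the element `Φ₂(Base Ψγ)(x)` lies in
the class `e_A 𝔭` whenever `Φ₁(Base γ)` carries `𝔭′` into `𝔭`.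
[cite: MochizukiFrdI2008, Thm. 4.2 (ii) p.77] -/
theorem Setting.exists_primesEquiv_naturality_baseIso (S : Setting F₁ F₂ Ψ) :
    ∃ e : ∀ A : C₁, Primes (Φ₁.obj (op (PreFrobenioid.baseObj F₁ A))) ≃
        Primes (Φ₂.obj (op (PreFrobenioid.baseObj F₂ (Ψ.functor.obj A)))),
      ∀ {A A' : C₁} (γ : A ⟶ A'), PreFrobenioid.IsBaseIso F₁ γ →
        ∀ (𝔭 : Primes (Φ₁.obj (op (PreFrobenioid.baseObj F₁ A))))
          (𝔭' : Primes (Φ₁.obj (op (PreFrobenioid.baseObj F₁ A')))),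
          (∃ p' ∈ 𝔭'.carrier, pull Φ₁ (PreFrobenioid.Base F₁ γ) p' ∈ 𝔭.carrier) →
            ∀ x ∈ (e A' 𝔭').carrier,
              pull Φ₂ (PreFrobenioid.Base F₂ (Ψ.functor.map γ)) x ∈ (e A 𝔭).carrier := by
  open PreFrobenioid in
  classical
  have hF₁ := S.isFrobenioid₁
  have hF₂ := S.isFrobenioid₂
  -- the family `e = Ψ^Prime`, one object at a time, with its characteristic property (row T42-L08)
  have H := fun X : C₁ => existsUnique_primesEquiv Ψ hF₁ hF₂ S.isotropic₁ S.isotropic₂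
    S.perfFactorial₁ S.perfFactorial₂ S.preStep_map S.preStep_inv X
    (fun E ε hε => S.isPrimaryPreStep_map hε) (fun Z ξ hξ => S.isPrimaryPreStep_inverse_map hξ)
  choose e he using fun X => (H X).exists
  have he' : ∀ (X : C₁) ⦃E : C₁⦄ (ε : E ⟶ X) (hε : IsPrimaryPreStep F₁ ε)
      (𝔭 : Primes (Φ₁.obj (op (baseObj F₁ X)))), invDiv F₁ ε hε.1.2 ∈ 𝔭.carrier →
        ∀ h₂ : IsBaseIso F₂ (Ψ.functor.map ε), invDiv F₂ (Ψ.functor.map ε) h₂ ∈ (e X 𝔭).carrier :=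
    fun X E ε hε 𝔭 h _ => he X ε hε 𝔭 h
  refine ⟨e, fun {A A'} γ hγ 𝔭 𝔭' hrel x hx => ?_⟩
  -- functoriality of `Ψ^Prime` on `C^bs-iso` (rows T42-L09/L10): SOME element of `e 𝔭′` pulls back into `e 𝔭`
  obtain ⟨q', hq', hq'pull⟩ := primesEquiv_naturality_baseIso_mem Ψ hF₁ hF₂ S.perfect₁ S.perfect₂
    S.isotropic₁ S.isotropic₂ S.perfFactorial₁ S.perfFactorial₂ S.preStep_map S.preStep_inv
    S.frobeniusType_map (fun _ _ _ hφ => S.isPrimaryPreStep_map hφ) e he' γ hγ 𝔭 𝔭' hrel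
  -- hence EVERY element of `e 𝔭′` does: `x ≼ q′ ≼ x` and `Φ₂(Base Ψγ)` is monotone
  haveI : IsIso (Base F₂ (Ψ.functor.map γ)) := S.isBaseIso_map γ hγ
  have hxprim : IsPrimary (pull Φ₂ (Base F₂ (Ψ.functor.map γ)) x) :=
    (isPrimary_pull_iff (Base F₂ (Ψ.functor.map γ)) x).mpr hx.1
  exact Primes.mem_carrier_of_precsim _ hq'pull hxprim.1 ((Primes.precsim_of_mem_carrier _ hx hq').map _)

set_option backward.isDefEq.respectTransparency false in
/-- **`Ψ` preserves Div-equivalent pairs of base-isomorphisms** ([FrdI] proof of Thm. 4.9, p. 90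
ll. 77–79: "[cf. Theorem 4.2, (ii); the fact that `Φ_i` is non-dilating]"): in the `T42.Setting`, if
`Φ₂` is non-dilating (Def. 1.1 (ii); part of "standard type", Def. 3.1 (i)(e)), then for base-isomorphisms
`φ, ψ : X → Y` of `C₁` with `Φ₁(Base φ) = Φ₁(Base ψ)` one has `Φ₂(Base Ψφ) = Φ₂(Base Ψψ)`. This is the
binder `hdiveq` of row T49-L08′ (`FrdI.T49.PsiPreservesTwinPrimary'`) and of
`FrdI.T49.exists_twinPrimary_pair_of_isStrictlyRational`, discharged.
[cite: MochizukiFrdI2008, Thm. 4.9 p.90] -/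
theorem Setting.divEquivalent_map (S : Setting F₁ F₂ Ψ) (hnd₂ : IsNonDilatingOn Φ₂) {X Y : C₁}
    (φ ψ : X ⟶ Y) (hφ : PreFrobenioid.IsBaseIso F₁ φ) (hψ : PreFrobenioid.IsBaseIso F₁ ψ)
    (h : PreFrobenioid.DivEquivalent F₁ φ ψ) :
    PreFrobenioid.DivEquivalent F₂ (Ψ.functor.map φ) (Ψ.functor.map ψ) := by
  open PreFrobenioid in
  classical
  have hF₁ := S.isFrobenioid₁
  have hF₂ := S.isFrobenioid₂
  have hP₂ := hF₂.isPreFrobenioid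
  obtain ⟨e, he⟩ := S.exists_primesEquiv_naturality_baseIso
  haveI : IsIso (Base F₁ φ) := hφ
  haveI : IsIso (Base F₂ (Ψ.functor.map φ)) := S.isBaseIso_map φ hφ
  haveI : IsIso (Base F₂ (Ψ.functor.map ψ)) := S.isBaseIso_map ψ hψ
  -- the endomorphism `f := Base(Ψψ)⁻¹ ≫ Base(Ψφ)` of `(Ψ Y)_D`; `f^* = Φ₂(Base Ψψ)⁻¹ ∘ Φ₂(Base Ψφ)`
  let f : baseObj F₂ (Ψ.functor.obj Y) ⟶ baseObj F₂ (Ψ.functor.obj Y) :=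
    inv (Base F₂ (Ψ.functor.map ψ)) ≫ Base F₂ (Ψ.functor.map φ)
  -- `f^*` maps every primary `x` `≼`-below itself: both `Φ₂(Base Ψφ)` and `Φ₂(Base Ψψ)` carry the prime of
  -- `x` into ONE prime of `Φ₂((Ψ X)_D)`, namely `e_X 𝔭` for `𝔭 = Φ₁(Base φ)(𝔭′) = Φ₁(Base ψ)(𝔭′)`
  have hle : ∀ x : Φ₂.obj (op (baseObj F₂ (Ψ.functor.obj Y))), IsPrimary x → pull Φ₂ f x ≼ x := by
    intro x hx
    -- the prime `𝔮′ ∋ x` of `Φ₂((Ψ Y)_D)` is `e_Y 𝔭′`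
    obtain ⟨𝔭', h𝔭'⟩ := (e Y).surjective (Quotient.mk _ ⟨x, hx⟩)
    have hx' : x ∈ (e Y 𝔭').carrier := by rw [h𝔭']; exact mem_carrier_mk_of_isPrimary hx
    -- a primary `p′ ∈ 𝔭′` and its pull-back `p = Φ₁(Base φ)(p′) = Φ₁(Base ψ)(p′)`, of class `𝔭`
    obtain ⟨⟨p', hp'⟩, hp'𝔭⟩ := Quotient.exists_rep 𝔭'
    have hp'mem : p' ∈ 𝔭'.carrier := by rw [← hp'𝔭]; exact mem_carrier_mk_of_isPrimary hp'
    have hpprim : IsPrimary (pull Φ₁ (Base F₁ φ) p') := (isPrimary_pull_iff (Base F₁ φ) p').mpr hp'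
    let 𝔭 : Primes (Φ₁.obj (op (baseObj F₁ X))) := Quotient.mk _ ⟨_, hpprim⟩
    have hpmem : pull Φ₁ (Base F₁ φ) p' ∈ 𝔭.carrier := mem_carrier_mk_of_isPrimary hpprim
    have hrelφ : ∃ p' ∈ 𝔭'.carrier, pull Φ₁ (Base F₁ φ) p' ∈ 𝔭.carrier := ⟨p', hp'mem, hpmem⟩
    have hrelψ : ∃ p' ∈ 𝔭'.carrier, pull Φ₁ (Base F₁ ψ) p' ∈ 𝔭.carrier :=
      ⟨p', hp'mem, by rw [show pull Φ₁ (Base F₁ ψ) = pull Φ₁ (Base F₁ φ) from h.symm]; exact hpmem⟩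
    -- naturality along `φ` and along `ψ`
    have h1 : pull Φ₂ (Base F₂ (Ψ.functor.map φ)) x ∈ (e X 𝔭).carrier := he φ hφ 𝔭 𝔭' hrelφ x hx'
    have h2 : pull Φ₂ (Base F₂ (Ψ.functor.map ψ)) x ∈ (e X 𝔭).carrier := he ψ hψ 𝔭 𝔭' hrelψ x hx'
    -- `f^* x = Φ₂(Base Ψψ)⁻¹ (Φ₂(Base Ψφ) x) ≼ Φ₂(Base Ψψ)⁻¹ (Φ₂(Base Ψψ) x) = x`
    have hcalc : pull Φ₂ f x =
        pull Φ₂ (inv (Base F₂ (Ψ.functor.map ψ))) (pull Φ₂ (Base F₂ (Ψ.functor.map φ)) x) := by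
      simp only [f, pull_comp]
    have hback : pull Φ₂ (inv (Base F₂ (Ψ.functor.map ψ))) (pull Φ₂ (Base F₂ (Ψ.functor.map ψ)) x) = x := by
      rw [← pull_comp, IsIso.inv_hom_id, pull_id]
    rw [hcalc]
    have h3 : pull Φ₂ (inv (Base F₂ (Ψ.functor.map ψ))) (pull Φ₂ (Base F₂ (Ψ.functor.map φ)) x) ≼
        pull Φ₂ (inv (Base F₂ (Ψ.functor.map ψ))) (pull Φ₂ (Base F₂ (Ψ.functor.map ψ)) x) :=
      (Primes.precsim_of_mem_carrier _ h1 h2).map _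
    rwa [hback] at h3
  -- `Φ₂` non-dilating ⇒ `f^* = id`
  have hid : pull Φ₂ f = MonoidHom.id _ := pull_eq_id_of_precsim_of_isPrimary hP₂ hnd₂ f hle
  -- conclusion: `Φ₂(Base Ψφ) = Φ₂(Base Ψψ) ∘ f^* = Φ₂(Base Ψψ)`
  unfold DivEquivalent
  ext x
  have hx := congrArg (fun g => pull Φ₂ (Base F₂ (Ψ.functor.map ψ)) (g x)) hid
  simp only [f, pull_comp, MonoidHom.id_apply] at hx
  rw [← pull_comp, ← pull_comp, Category.assoc, IsIso.hom_inv_id_assoc] at hx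
  simpa using hx

end FrdI.T42

end Literature.AlgebraicGeometry.Frobenioids
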